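import Mathlib
import Summits.Ventures.PercRepro.TriangleCapTopValues

/-!
# PercRepro — THE LOCI OF THE BAND VALUES ON THE CELL (p3, gen 50; part 219a)

`cherry_band_locus` (`r ≥ 10`, `4 (r − 3) + 6 < stabGapFull k a r`, `j ≤ 3`): a `K₄⁻`-free graph at
`closed − (4 (r − 3) + 2 j)` is `a`-bipartite and its missing graph has a vertex `w` of degree `r − 2` whose two
off-pairs `e ≠ f` have `|N(w) ∩ e| + |N(w) ∩ f| + |e ∩ f| = 3 − j` — `j = 0` the fourth-best locus (part 212),
`j = 1` the fifth (two pairs at two leaves, or a path of length two hung at a leaf), `j = 2` exactly one incidence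
(a pair at a leaf plus a disjoint pair, or a cherry hung off the star), `j = 3` no incidence at all (two pairs
disjoint from each other and from the star's leaves).  Axioms: standard.
-/

namespace PercRepro

namespace TriangleCap

namespace C047

open Finset

/-- **THE BAND LOCI ON THE CELL:** for `3 ≤ a`, `10 ≤ r`, `2 a + r ≤ k` (`r + 7 ≤ k` at `a = 3`), `j ≤ 3` and
`4 (r − 3) + 6 < stabGapFull k a r`, every `K₄⁻`-free graph at `closed − (4 (r − 3) + 2 j)` is `a`-bipartite with a
vertex `w` of missing degree `r − 2` whose two off-pairs have incidence count `3 − j`. -/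
theorem cherry_band_locus (k a r : ℕ) (ha3 : 3 ≤ a) (hr10 : 10 ≤ r) (hk : 2 * a + r ≤ k)
    (hk3 : a = 3 → r + 7 ≤ k) (j : ℕ) (hj : j ≤ 3) (hlt : 4 * (r - 3) + 6 < stabGapFull k a r)
    (D : SimpleGraph (Fin k)) [DecidableRel D.Adj] (hK : K4mFree D) (hm : D.edgeFinset.card + r = a * (k - a))
    (heq : ∑ v, deg D v * deg D v + r * (k - 1 - r) + (4 * (r - 3) + 2 * j) = D.edgeFinset.card * k) :
    ∃ A : Finset (Fin k), A.card = a ∧ BipSub D A ∧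
      ∃ w, deg (missingGraph D A) w + 2 = r ∧ ∃ e f, e ∈ (missingGraph D A).edgeFinset ∧
        f ∈ (missingGraph D A).edgeFinset ∧ e ≠ f ∧ w ∉ e ∧ w ∉ f ∧
        (∀ g ∈ (missingGraph D A).edgeFinset, w ∈ g ∨ g = e ∨ g = f) ∧
        (univ.filter (fun v => (missingGraph D A).Adj w v ∧ v ∈ e)).card +
          (univ.filter (fun v => (missingGraph D A).Adj w v ∧ v ∈ f)).card +
          (univ.filter (fun v => v ∈ e ∧ v ∈ f)).card + j = 3 := by
  have hcard : Fintype.card (Fin k) = k := Fintype.card_fin k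
  have hbip : ∃ A : Finset (Fin k), A.card = a ∧ BipSub D A := by
    by_contra hnb
    have h := (stab_table_rows_ge_three k a r ha3 hk (by omega) hk3).1 D hK hm hnb
    omega
  obtain ⟨A, hA, hB⟩ := hbip
  refine ⟨A, hA, hB, ?_⟩
  have hH := bipSub_sum_deg_sq_add_disjEdgePairs D A hB a r hA (by rw [hcard]; exact hm) (by rw [hcard]; omega)
  rw [hcard] at hH
  have hr : (missingGraph D A).edgeFinset.card = r := card_edges_missingGraph D A hB a r hA (by rw [hcard]; exact hm)
  have hid := sum_deg_sq_add_disjEdgePairs (missingGraph D A)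
  rw [hr] at hid
  have hS : ∑ v, deg (missingGraph D A) v * deg (missingGraph D A) v + 4 * (r - 3) + 2 * j = r * (r + 1) := by
    omega
  exact band_locus (missingGraph D A) (cliqueFree_of_bipSub _ A (bipSub_missingGraph D A)) r hr10 hr j hj hS

end C047

end TriangleCap

end PercRepro
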